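import Summits.AtomisticToContinuum.FouriersLaw.Theorems.VanishingNoiseTransferNoiseLocalityStubResponseDensityNoisyAux7

/-!
# Duhamel flip bound, part 1: smooth flip test functions, the response coefficient as a pairing,
and the weak adjoint equation of a flip-noisy response density
(helpers for stub `stub_duhamelFlipBound`)

Helper file `--supports stmt-AtomisticToContinuum-11975` (crux `NoiseLocality`, route
`VanishingNoiseTransfer`, line `relative-flip-energy-transfer`, stub 2 `stub_duhamelFlipBound`).

For the pinned chain `P = pinnedChain ω₂ lam β γ`, the Gibbs measure `μ_T = gibbsMeasure N T` and a
family `μ T_L T_R` of weak steady states of the flip-noisy generator `L + εS` (any rate `ε`, so `ε = 0`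
covers the deterministic family) with `μ T T = μ_T`:

* `contDiff_momentumFlip`, `contDiff_flipNoise`, `contDiff_flipGenerator` — `Θ_i`, `S f` and
  `(L + εS) f` are smooth for smooth `f` (so `(L + εS) f` is again a test function);
* `responseCoeff_eq` — if `δ ↦ totalCurrent μ_{T+δ/2,T-δ/2}` has derivative `c` at `0` and the
  response quotients `totalCurrent(μ_δ)/δ` tend to `D` along `𝓝[≠] 0`, then `D = c`
  (`totalCurrent μ_T = 0`, uniqueness of limits);
* `integral_flipGenerator_mul_responseDensity` — **the weak adjoint equation**: if
  `d/dδ ∫ g dμ_δ |₀ = ∫ g U dμ_T` for every `g ∈ C_c^∞` (`HasDerivAt` form), then for `N ≥ 2` and every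
  `F ∈ C_c^∞`, `∫ (L_{T,T} F + ε S F) U dμ_T = -(γ/2) ∫ (∂²_{p_0} F - ∂²_{p_{N-1}} F) dμ_T`
  (differentiate `∫ (L_δ + εS) F dμ_δ = 0`, `L_δ = L_0 + (γδ/2)(∂²_{p_0} - ∂²_{p_{N-1}})`);
* `integral_flipGenerator_mul_responseDensity_gibbs` — the same with the McLennan source:
  `∫ (L_{T,T} F + ε S F) U dμ_T = -∫ F φ dμ_T`, `φ = γ (p_0² - p_{N-1}²)/(2T²)` (two Gaussian
  integrations by parts, `integral_partialP_partialP_gibbsMeasure`).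

No definitions.
-/

noncomputable section

open MeasureTheory Filter Topology
open scoped ContDiff

namespace Summit.AtomisticToContinuum.FouriersLaw.Theorems.NoiseLocality.StubDuhamelFlipBound

open Literature.MathematicalPhysics.KineticTheory.HeatConduction
open Summit.AtomisticToContinuum.FouriersLaw.Theorems.OddSectorIrreversibility
open Summit.AtomisticToContinuum.FouriersLaw.Theorems.NoiseLocality.StubResponseDensityNoisy

variable {N : ℕ}

/-! ### Smoothness of the flip test functions -/

/-- The single-site momentum flip `Θ_i (q, p) = (q, p[i ↦ -p_i])` is smooth (it is linear). -/
theorem contDiff_momentumFlip (i : Fin N) : ContDiff ℝ ∞ (momentumFlip (N := N) i) := by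
  have h2 : ContDiff ℝ ∞ fun x : PhaseSpace N => Function.update x.2 i (-x.2 i) := by
    refine contDiff_pi.2 fun j => ?_
    by_cases h : j = i
    · subst h
      simp only [Function.update_self]
      fun_prop
    · simp only [Function.update_of_ne h]
      fun_prop
  exact contDiff_fst.prodMk h2

/-- `S f = ∑_i (f ∘ Θ_i - f)` is smooth for smooth `f`. -/
theorem contDiff_flipNoise {f : PhaseSpace N → ℝ} (hf : ContDiff ℝ ∞ f) :
    ContDiff ℝ ∞ (flipNoise N f) := by
  have e : flipNoise N f = fun x => ∑ i : Fin N, (f (momentumFlip i x) - f x) :=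
    funext (flipNoise_eq N f)
  rw [e]
  exact ContDiff.sum fun i _ => (hf.comp (contDiff_momentumFlip i)).sub hf

/-- `(L + εS) f` is smooth for smooth `f` (pinned chain: polynomial potentials). -/
theorem contDiff_flipGenerator (ω₂ lam β γ : ℝ) (N : ℕ) (T_L T_R ε : ℝ) {f : PhaseSpace N → ℝ}
    (hf : ContDiff ℝ ∞ f) :
    ContDiff ℝ ∞ ((pinnedChain ω₂ lam β γ).flipGenerator N T_L T_R ε f) := by
  have e : (pinnedChain ω₂ lam β γ).flipGenerator N T_L T_R ε f = fun x =>
      (pinnedChain ω₂ lam β γ).generator N T_L T_R f x + ε * flipNoise N f x :=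
    funext fun x => (pinnedChain ω₂ lam β γ).flipGenerator_eq_add_flipNoise N T_L T_R ε f x
  rw [e]
  exact (contDiff_generator _ (pinnedChain_contDiff_U ω₂ lam β γ) (pinnedChain_contDiff_V ω₂ lam β γ)
    N T_L T_R hf).add (contDiff_const.mul (contDiff_flipNoise hf))

/-! ### The response coefficient is the derivative of the total current -/

/-- **The response coefficient as a derivative.** If `μ T T` is the Gibbs measure of the pinned chain
(which carries no current), `δ ↦ totalCurrent μ_{T+δ/2,T-δ/2}` has derivative `c` at `δ = 0`, and the
response quotients `totalCurrent(μ_{T+δ/2,T-δ/2})/δ` converge to `D` along `𝓝[≠] 0`, then `D = c`. -/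
theorem responseCoeff_eq {ω₂ lam β γ : ℝ} {T : ℝ} (μ : ℝ → ℝ → Measure (PhaseSpace N))
    (hπ : μ T T = (pinnedChain ω₂ lam β γ).gibbsMeasure N T) {c D : ℝ}
    (hderiv : HasDerivAt (fun δ : ℝ =>
      (pinnedChain ω₂ lam β γ).totalCurrent (μ (T + δ / 2) (T - δ / 2))) c 0)
    (hD : Tendsto (fun δ : ℝ =>
      (pinnedChain ω₂ lam β γ).totalCurrent (μ (T + δ / 2) (T - δ / 2)) / δ) (𝓝[≠] 0) (𝓝 D)) :
    D = c := by
  rw [hasDerivAt_iff_tendsto_slope] at hderiv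
  have h0 : (pinnedChain ω₂ lam β γ).totalCurrent (μ (T + 0 / 2) (T - 0 / 2)) = 0 := by
    rw [zero_div, add_zero, sub_zero, hπ, pinnedChain_totalCurrent_gibbsMeasure]
  have h' : Tendsto (fun δ : ℝ =>
      (pinnedChain ω₂ lam β γ).totalCurrent (μ (T + δ / 2) (T - δ / 2)) / δ) (𝓝[≠] 0) (𝓝 c) := by
    refine hderiv.congr' (Eventually.of_forall fun δ => ?_)
    rw [slope_def_field, h0, sub_zero, sub_zero]
  exact tendsto_nhds_unique hD h'

/-! ### The weak adjoint equation of a flip-noisy response density -/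

/-- **Differentiating weak flip-stationarity.** Let `μ T_L T_R` be weak steady states of `L + εS`
(pinned chain, `N ≥ 2`, `T > 0`, any rate `ε`) for all `T_L, T_R > 0` with `μ T T = μ_T`, and let `U`
be a response density of the family at `T` on test functions:
`HasDerivAt (δ ↦ ∫ g dμ_{T+δ/2,T-δ/2}) (∫ g U dμ_T) 0` for every `g ∈ C_c^∞`. Then for every `F ∈ C_c^∞`
`∫ (L_{T,T} F + ε S F) U dμ_T = -(γ/2) ∫ (∂²_{p_0}F - ∂²_{p_{N-1}}F) dμ_T`: apply stationarity of `μ_δ`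
to `F`, split `L_δ + εS = (L_0 + εS) + (γδ/2)(∂²_{p_0} - ∂²_{p_{N-1}})`, divide by `δ` and let `δ → 0`
(response at the test function `(L_0 + εS)F`, continuity at the test function `(∂²_{p_0} - ∂²_{p_{N-1}})F`). -/
theorem integral_flipGenerator_mul_responseDensity {ω₂ lam β γ : ℝ} (hN : 2 ≤ N) {T : ℝ} (hT : 0 < T)
    (ε : ℝ) (μ : ℝ → ℝ → Measure (PhaseSpace N))
    (hμ : ∀ T_L T_R : ℝ, 0 < T_L → 0 < T_R →
      (pinnedChain ω₂ lam β γ).IsFlipSteadyState N T_L T_R ε (μ T_L T_R))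
    (hπ : μ T T = (pinnedChain ω₂ lam β γ).gibbsMeasure N T)
    {U : PhaseSpace N → ℝ}
    (hresp : ∀ g : PhaseSpace N → ℝ, ContDiff ℝ ∞ g → HasCompactSupport g →
      HasDerivAt (fun δ : ℝ => ∫ x, g x ∂(μ (T + δ / 2) (T - δ / 2)))
        (∫ x, g x * U x ∂((pinnedChain ω₂ lam β γ).gibbsMeasure N T)) 0)
    {F : PhaseSpace N → ℝ} (hF : ContDiff ℝ ∞ F) (hFc : HasCompactSupport F) :
    ∫ x, (pinnedChain ω₂ lam β γ).flipGenerator N T T ε F x * U x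
        ∂((pinnedChain ω₂ lam β γ).gibbsMeasure N T) =
      -(γ / 2) * ∫ x, (partialP ⟨0, by omega⟩ (partialP ⟨0, by omega⟩ F) x -
        partialP ⟨N - 1, by omega⟩ (partialP ⟨N - 1, by omega⟩ F) x)
          ∂((pinnedChain ω₂ lam β γ).gibbsMeasure N T) := by
  set P := pinnedChain ω₂ lam β γ with hP
  set π := P.gibbsMeasure N T with hπ_def
  have hγ' : P.γ = γ := rfl
  set b₀ : Fin N := ⟨0, by omega⟩ with hb₀
  set b₁ : Fin N := ⟨N - 1, by omega⟩ with hb₁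
  set LF : PhaseSpace N → ℝ := P.flipGenerator N T T ε F with hLF
  set G : PhaseSpace N → ℝ := fun x => partialP b₀ (partialP b₀ F) x - partialP b₁ (partialP b₁ F) x
    with hG
  -- the two test functions
  have hLs : ContDiff ℝ ∞ LF := contDiff_flipGenerator ω₂ lam β γ N T T ε hF
  have hLc : HasCompactSupport LF := hasCompactSupport_flipGenerator ω₂ lam β γ N T T ε hF hFc
  have h0 := contDiff_hasCompactSupport_partialP_partialP hF hFc b₀
  have h1 := contDiff_hasCompactSupport_partialP_partialP hF hFc b₁
  have hGs : ContDiff ℝ ∞ G := h0.1.sub h1.1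
  have hGc : HasCompactSupport G := h0.2.sub h1.2
  -- stationarity at `δ = 0`
  have hst0 : ∫ x, LF x ∂π = 0 := by
    have h := (hμ T T hT hT).2.1 F hF hFc
    rwa [hπ] at h
  -- the identity `(∫ LF dμ_δ)/δ = -(γ/2) ∫ G dμ_δ` for `0 < |δ| < 2T`
  have key : ∀ᶠ δ in 𝓝[≠] (0 : ℝ),
      (∫ x, LF x ∂(μ (T + δ / 2) (T - δ / 2))) / δ =
        -(γ / 2) * ∫ x, G x ∂(μ (T + δ / 2) (T - δ / 2)) := by
    have h2 : ∀ᶠ δ in 𝓝 (0 : ℝ), δ < 2 * T := eventually_lt_nhds (by linarith)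
    have h2' : ∀ᶠ δ in 𝓝 (0 : ℝ), -(2 * T) < δ := eventually_gt_nhds (by linarith)
    filter_upwards [mem_nhdsWithin_of_mem_nhds h2, mem_nhdsWithin_of_mem_nhds h2',
      self_mem_nhdsWithin] with δ hlt hgt hne
    have ha : 0 < T + δ / 2 := by linarith
    have hb : 0 < T - δ / 2 := by linarith
    set ν := μ (T + δ / 2) (T - δ / 2) with hν
    haveI : IsProbabilityMeasure ν := (hμ _ _ ha hb).1
    have hst : ∫ x, P.flipGenerator N (T + δ / 2) (T - δ / 2) ε F x ∂ν = 0 := (hμ _ _ ha hb).2.1 F hF hFc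
    have hsplit : ∀ x, P.flipGenerator N (T + δ / 2) (T - δ / 2) ε F x = LF x + (γ * δ / 2) * G x := by
      intro x
      rw [flipGenerator_temp_split P N T δ ε F x, sum_bath_two hN, hγ']
      simp only [hLF, hG, hb₀, hb₁]
      ring
    simp_rw [hsplit] at hst
    have hiL : Integrable LF ν := integrable_of_continuous_hasCompactSupport hLs.continuous hLc ν
    have hiG : Integrable G ν := integrable_of_continuous_hasCompactSupport hGs.continuous hGc ν
    rw [integral_add hiL (hiG.const_mul _), integral_const_mul] at hst
    have hne' : (δ : ℝ) ≠ 0 := hne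
    field_simp
    linarith
  -- response at `LF`: the slopes converge to `∫ LF · U dμ_T`
  have hA : Tendsto (fun δ : ℝ => -(γ / 2) * ∫ x, G x ∂(μ (T + δ / 2) (T - δ / 2))) (𝓝[≠] 0)
      (𝓝 (∫ x, LF x * U x ∂π)) := by
    have h := hresp LF hLs hLc
    rw [hasDerivAt_iff_tendsto_slope] at h
    have h' : Tendsto (fun δ : ℝ => (∫ x, LF x ∂(μ (T + δ / 2) (T - δ / 2))) / δ)
        (𝓝[≠] 0) (𝓝 (∫ x, LF x * U x ∂π)) := by
      refine h.congr' (Eventually.of_forall fun δ => ?_)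
      rw [slope_def_field]
      simp only [zero_div, add_zero, sub_zero]
      rw [hπ, hst0, sub_zero]
    exact h'.congr' key
  -- continuity at `G`: `∫ G dμ_δ → ∫ G dμ_T`
  have hB : Tendsto (fun δ : ℝ => ∫ x, G x ∂(μ (T + δ / 2) (T - δ / 2))) (𝓝[≠] 0)
      (𝓝 (∫ x, G x ∂π)) := by
    have h := (hresp G hGs hGc).continuousAt.tendsto
    simp only [zero_div, add_zero, sub_zero] at h
    rw [hπ] at h
    exact h.mono_left nhdsWithin_le_nhds
  have hB' := hB.const_mul (-(γ / 2))
  exact tendsto_nhds_unique hA hB'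

/-- **The weak adjoint equation, Gibbs form.** Under the hypotheses of
`integral_flipGenerator_mul_responseDensity` (pinned chain with `ω₂ > 0`, `lam, β ≥ 0`, `N ≥ 2`, `T > 0`):
for every `F ∈ C_c^∞`, `∫ (L_{T,T} F + ε S F) U dμ_T = -∫ F φ dμ_T` with the McLennan source
`φ(q,p) = γ (p_0² - p_{N-1}²)/(2T²)` (formally `(L + εS)† U = -φ`). -/
theorem integral_flipGenerator_mul_responseDensity_gibbs {ω₂ lam β γ : ℝ} (hω : 0 < ω₂) (hl : 0 ≤ lam)
    (hβ : 0 ≤ β) (hN : 2 ≤ N) {T : ℝ} (hT : 0 < T) (ε : ℝ) (μ : ℝ → ℝ → Measure (PhaseSpace N))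
    (hμ : ∀ T_L T_R : ℝ, 0 < T_L → 0 < T_R →
      (pinnedChain ω₂ lam β γ).IsFlipSteadyState N T_L T_R ε (μ T_L T_R))
    (hπ : μ T T = (pinnedChain ω₂ lam β γ).gibbsMeasure N T)
    {U : PhaseSpace N → ℝ}
    (hresp : ∀ g : PhaseSpace N → ℝ, ContDiff ℝ ∞ g → HasCompactSupport g →
      HasDerivAt (fun δ : ℝ => ∫ x, g x ∂(μ (T + δ / 2) (T - δ / 2)))
        (∫ x, g x * U x ∂((pinnedChain ω₂ lam β γ).gibbsMeasure N T)) 0)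
    {F : PhaseSpace N → ℝ} (hF : ContDiff ℝ ∞ F) (hFc : HasCompactSupport F) :
    ∫ x, (pinnedChain ω₂ lam β γ).flipGenerator N T T ε F x * U x
        ∂((pinnedChain ω₂ lam β γ).gibbsMeasure N T) =
      -∫ x, F x * (γ / (2 * T ^ 2) * (x.2 ⟨0, by omega⟩ ^ 2 - x.2 ⟨N - 1, by omega⟩ ^ 2))
        ∂((pinnedChain ω₂ lam β γ).gibbsMeasure N T) := by
  set P := pinnedChain ω₂ lam β γ with hP
  have key := integral_flipGenerator_mul_responseDensity hN hT ε μ hμ hπ hresp hF hFc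
  rw [key]
  have hU : ContDiff ℝ 1 P.U := pinnedChain_contDiff_U ω₂ lam β γ
  have hV : ContDiff ℝ 1 P.V := pinnedChain_contDiff_V ω₂ lam β γ
  have hf2 : ContDiff ℝ 2 F := hF.of_le (by norm_cast)
  haveI : IsProbabilityMeasure (P.gibbsMeasure N T) :=
    pinnedChain_isProbabilityMeasure_gibbsMeasure hω hl hβ γ N hT
  have hi : ∀ i : Fin N, Integrable (partialP i (partialP i F)) (P.gibbsMeasure N T) := fun i =>
    integrable_of_continuous_hasCompactSupport
      (contDiff_hasCompactSupport_partialP_partialP hF hFc i).1.continuous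
      (contDiff_hasCompactSupport_partialP_partialP hF hFc i).2 _
  have hc0 : Continuous fun x : PhaseSpace N => F x * (x.2 ⟨0, by omega⟩ ^ 2 - T) :=
    hF.continuous.mul ((((continuous_apply (⟨0, by omega⟩ : Fin N)).comp continuous_snd).pow 2).sub
      continuous_const)
  have hc1 : Continuous fun x : PhaseSpace N => F x * (x.2 ⟨N - 1, by omega⟩ ^ 2 - T) :=
    hF.continuous.mul ((((continuous_apply (⟨N - 1, by omega⟩ : Fin N)).comp continuous_snd).pow 2).sub
      continuous_const)
  have i0 : Integrable (fun x : PhaseSpace N => F x * (x.2 ⟨0, by omega⟩ ^ 2 - T)) (P.gibbsMeasure N T) :=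
    integrable_of_continuous_hasCompactSupport hc0 hFc.mul_right _
  have i1 : Integrable (fun x : PhaseSpace N => F x * (x.2 ⟨N - 1, by omega⟩ ^ 2 - T))
      (P.gibbsMeasure N T) :=
    integrable_of_continuous_hasCompactSupport hc1 hFc.mul_right _
  have eR : ∫ x, F x * (γ / (2 * T ^ 2) * (x.2 ⟨0, by omega⟩ ^ 2 - x.2 ⟨N - 1, by omega⟩ ^ 2))
      ∂(P.gibbsMeasure N T) = γ / (2 * T ^ 2) *
        ((∫ x, F x * (x.2 ⟨0, by omega⟩ ^ 2 - T) ∂(P.gibbsMeasure N T)) -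
          ∫ x, F x * (x.2 ⟨N - 1, by omega⟩ ^ 2 - T) ∂(P.gibbsMeasure N T)) := by
    rw [← integral_sub i0 i1, ← integral_const_mul]
    refine integral_congr_ae (Eventually.of_forall fun x => ?_)
    ring
  rw [integral_sub (hi _) (hi _), integral_partialP_partialP_gibbsMeasure P hU hV N hT.ne' hf2 hFc,
    integral_partialP_partialP_gibbsMeasure P hU hV N hT.ne' hf2 hFc, eR]
  field_simp

/-! ### Registered helper sub-goal (stub form, one line) -/

/-- Registered helper sub-goal `helper_duhamelWeakAdjointFlip` of stub `stub_duhamelFlipBound`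
(= `integral_flipGenerator_mul_responseDensity_gibbs` in stub form, the two bath sites `a = 0`,
`b = N - 1` passed by value): the weak adjoint equation of a flip-noisy response density, Gibbs form. -/
theorem helper_duhamelWeakAdjointFlip : ∀ ω₂ lam β γ : ℝ, 0 < ω₂ → 0 ≤ lam → 0 ≤ β → ∀ (N : ℕ), 2 ≤ N → ∀ (T : ℝ), 0 < T → ∀ (ε : ℝ) (μ : ℝ → ℝ → MeasureTheory.Measure (Literature.MathematicalPhysics.KineticTheory.HeatConduction.PhaseSpace N)), (∀ T_L T_R : ℝ, 0 < T_L → 0 < T_R → (Literature.MathematicalPhysics.KineticTheory.HeatConduction.pinnedChain ω₂ lam β γ).IsFlipSteadyState N T_L T_R ε (μ T_L T_R)) → μ T T = (Literature.MathematicalPhysics.KineticTheory.HeatConduction.pinnedChain ω₂ lam β γ).gibbsMeasure N T → ∀ U : Literature.MathematicalPhysics.KineticTheory.HeatConduction.PhaseSpace N → ℝ, (∀ g : Literature.MathematicalPhysics.KineticTheory.HeatConduction.PhaseSpace N → ℝ, ContDiff ℝ ((⊤ : ℕ∞) : WithTop ℕ∞) g → HasCompactSupport g → HasDerivAt (fun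 δ : ℝ => ∫ x, g x ∂(μ (T + δ / 2) (T - δ / 2))) (∫ x, g x * U x ∂((Literature.MathematicalPhysics.KineticTheory.HeatConduction.pinnedChain ω₂ lam β γ).gibbsMeasure N T)) 0) → ∀ (a b : Fin N), a.val = 0 → b.val = N - 1 → ∀ F : Literature.MathematicalPhysics.KineticTheory.HeatConduction.PhaseSpace N → ℝ, ContDiff ℝ ((⊤ : ℕ∞) : WithTop ℕ∞) F → HasCompactSupport F → ∫ x, (Literature.MathematicalPhysics.KineticTheory.HeatConduction.pinnedChain ω₂ lam β γ).flipGenerator N T T ε F x * U x ∂((Literature.MathematicalPhysics.KineticTheory.HeatConduction.pinnedChain ω₂ lam β γ).gibbsMeasure N T) = -∫ x, F x * (γ / (2 * T ^ 2) * (x.2 a ^ 2 - x.2 b ^ 2)) ∂((Literature.MathematicalPhysics.KineticTheory.HeatConduction.pinnedChain ω₂ lam β γ).gibbsMeasure N T) := by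
  intro ω₂ lam β γ hω hl hβ N hN T hT ε μ hμ hπ U hresp a b ha hb F hF hFc
  obtain ⟨av, hav⟩ := a
  obtain ⟨bv, hbv⟩ := b
  simp only at ha hb
  subst ha hb
  exact integral_flipGenerator_mul_responseDensity_gibbs hω hl hβ hN hT ε μ hμ hπ hresp hF hFc

end Summit.AtomisticToContinuum.FouriersLaw.Theorems.NoiseLocality.StubDuhamelFlipBound

end
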